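import Literature.MathematicalPhysics.QuantumLattice.HubbardHubbardModel
import Literature.MathematicalPhysics.QuantumLattice.HubbardModelProofs
import HarnessLib

/-!
# Discharge for the Hubbard target statements (`HubbardHubbardModel`): Yang's `η`-pairing eigenvectors

Family `hubbard` (trunk T-QLATTICE), statement hubbard.S08, first part. Sibling proof file of
`Literature/MathematicalPhysics/QuantumLattice/HubbardHubbardModel.lean` (next to
`HubbardHubbardModelProofs.lean`, which treats hubbard.S11): it proves the named fact
`Literature.MathematicalPhysics.QuantumLattice.yang_etaPairing_eigenvector` of that file, unconditionally, as
`Literature.MathematicalPhysics.QuantumLattice.yang_etaPairing_eigenvector_holds`. No statement is introduced or changed.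

The work is done upstream, from the concrete Jordan–Wigner model of wave 0:

* `FermionOperatorsProofs` — the CAR of the Jordan–Wigner matrices, `c_i |0⟩ = 0`, the bilinear
  commutators, `[T, η†] = 0` for a bipartite sign, `[Σ_x n_{x↑} n_{x↓}, η†] = η†`, hence Yang's
  `[H(t,U), η†] = U η†`, and the explicit form `(η†)^m |0⟩ = m! Σ_{#S = m} (∏_{x∈S} ε_x) |S × {↑,↓}⟩`
  with its non-vanishing for `m ≤ |Λ|`;
* `HubbardModelProofs` — `H (η†)^m |0⟩ = m U (η†)^m |0⟩` on any bipartite graph, and the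
  bipartiteness of the staggering sign `(-1)^{Σ xᵢ}` on tori of even side.

## Source

C. N. Yang, *η pairing and off-diagonal long-range order in a Hubbard model*, Phys. Rev. Lett.
**63** (1989) 2144–2147, eqs. (4)–(8): on the periodic cube of even side, with
`η† = Σ_r e^{iπ·r} c†_{r↑} c†_{r↓}`, `[H, η†] = 2W η†` (eq. (6), Yang's interaction `2W = U`),
so `ψ_N = (η†)^{N/2} |0⟩` (eq. (7)) satisfies `H ψ_N = N W ψ_N` (eq. (8)), i.e. energy `m U` for
`N = 2m ≤ M` electrons; the argument is dimension independent and is carried out here on the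
two-dimensional torus `(ℤ/Lℤ)²` of the vendored statement. Secondary: Essler–Frahm–Göhmann–
Klümper–Korepin, *The One-Dimensional Hubbard Model* (2005), §2.2.5.
-/

namespace Literature.MathematicalPhysics.QuantumLattice


/-- **Discharge of hubbard.S08, `yang_etaPairing_eigenvector`** (Yang's `η`-pairing
eigenstates). On the torus `(ℤ/Lℤ)²` of even side, for every hopping `t`, every interaction `U`
and every `m ≤ L²`, the state `(η†)^m |0⟩`, `η† = Σ_x (-1)^{x₁+x₂} c†_{x↑} c†_{x↓}`, is a nonzero
exact eigenvector of the Hubbard Hamiltonian with eigenvalue `m U`: non-vanishing by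
`etaPairingState_ne_zero` (`m ≤ L² = |Λ|`) and the eigenvalue equation by
`hubbardTorus_mulVec_etaPairingState_holds` (`[H, η†] = U η†` on the bipartite torus, `H |0⟩ = 0`).
Yang, PRL 63 (1989) 2144, eqs. (7)–(8). [cite: Yang1989, eqs. (7)–(8)] -/
theorem yang_etaPairing_eigenvector_holds {L : ℕ} : yang_etaPairing_eigenvector (L := L) := by
  intro hL t U m hm
  exact ⟨etaPairingState_ne_zero _ (by simpa using hm),
    hubbardTorus_mulVec_etaPairingState_holds hL t U m⟩

end Literature.MathematicalPhysics.QuantumLattice
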